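/-
Copyright (c) 2026 the pub-hodgecm-mathlib formalisation cell (harness21).  Prover seat hodgecm-mathlib-LH3-p04 (g4): line LH3 (closer stub `stub_N9`), organ O-L1e (X′-corners),
brick (X2-M) «TWO-PLACE (M-UNFOLD)» (LH3-plan (g4) RULING #18 deal 2026-09-02T10:55:54Z).
-/
import Literature.NumberTheory.Automorphic.ArchInnerFormSemiregularCentralizerBlock   -- ★ p850446 (M-UNFOLD) (u2): the §1 lemmas (`gprimeBlock_eq_relabel_circleDiagonal`, `commute_gprimeTorus_iff_forall`, …)
import HarnessLib

/-!
# The centraliser of a chart point with non-compact-wall coincidences at TWO places: `Z(gprimeTorus α S′ p) ≃ₜ* (B₁ × B₂) × K`, explicit form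
# ((M-UNFOLD) (u2), two-place edition; Rogawski 1990 §4.12, §8.2 p. 122)

Topic `NumberTheory/Automorphic`; namespace `Literature.NumberTheory.Automorphic.UnitaryGroup`.  THEOREMS ONLY (no `def`, no instance, no notation, no axiom, no named fact,
no `sorry`).  Cell `pub/hodgecm-mathlib`, crux H413 (`stmt-HodgeConjecture-24833`), F0∕P3c line LH3 (closer stub `stub_N9`), leaf v5 organ **O-L1e «X′-CORNERS»** (every
coincidence place one-wall, ≥ 2 places), in-house road (X1) F0P3a-p02 (g21) ∕ **(X2) TWO-BLOCK DESCENT BOX** LH3-p04 (g4) ∕ (X3) F0P3a-p02 + F0P3a-p04; this file is (X2)'s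
group-theoretic input **(X2-M)**: the two-place edition of ★ p850446∕p850499 `exists_continuousMulEquiv_centralizer_gprimeTorus_semireg(_explicit)` (LH5-p02 (g3)), whose
proof it follows line by line (same objects, one more place).

THE MATHEMATICS.  `G′_∞ = Π_w G′_w` (★ `archPiEquivCM`).  Let `p` be a chart point of the compact chart outside the admissible `S′` with a wall
`e^{i p_{w,0}} = e^{i p_{w,2}} ≠ e^{i p_{w,1}}` at each of TWO places `w = w₁, w₂ ∉ S′`, `w₁ ≠ w₂`, regular at every other place (`w ∉ S′`: distinct eigenvalues;
`w ∈ S′`: boost parameter `≠ 0`).  At `w_i` the component of `γ_p = gprimeTorus α S′ p` is the relabelled (`τ_i = lineOf (formSign α w_i)`) standard `{0,2}∣{1}`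
split-singular pattern, whose centraliser is the endoscopic block `ι_i(B_i × U₁)` (★ (V9)), `B_i := U(σ_{w_i} diag(α (τ_i 0), α (τ_i 2)))(ℂ)`; elsewhere the centraliser
is the chart torus component.  With the block projections `π_i : M′ →* B_i × U₁`, the commuting block embeddings `s_i : B_i →* M′` (supported at `w_i` only),
`π_{B_i} ∘ s_i = id`, `π_{B_i} ∘ s_j = 1` (`i ≠ j`), `s(b₁, b₂) := s₁(b₁) s₂(b₂)` and `K := ker (π_{B₁}, π_{B₂})` (CLOSED, `≤ T′`, commutative), the map
**`e_M g = ((π_{B₁} g, π_{B₂} g), s(π_B g)⁻¹ g)`, `e_M⁻¹((b₁, b₂), k) = s₁(b₁) s₂(b₂) k`** is an isomorphism of topological groups `M′ ≃ₜ* (B₁ × B₂) × K`.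
Bookkeeping clauses (numbered as in the one-place editions): [4] `g ∈ T′ ↔` both `B`-components of `e_M g` are unit diagonals; [5]₁ [5]₂ the `B_i`-component of
`e_M(gprimeTorus α S′ c)` is `diag(e^{i c_{w_i,0}}, e^{i c_{w_i,2}})`; [6] its `K`-component is the chart point at the DOUBLE tangential point
`update (update c w₁ (0, c_{w₁,1}, 0)) w₂ (0, c_{w₂,1}, 0)`; [7] `e_M(T′) = (A₁ × A₂) × ⊤`; [8]₁ [8]₂ `e_M⁻¹((b₁, 1), 1)`, `e_M⁻¹((1, b₂), 1)` are the block embeddings at `w₁`, `w₂` through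
★ `archPiEquivCM`, `e_{τ_i}`, ★ `endoEmb` (so `e_M⁻¹((b₁, b₂), 1)` is their product); [9]₁ [9]₂ the `w_i`-component of `g ∈ M′` is the block embedding of `((e_M g).1.i, u_i)`; [10] `e_M k = (1, k)` on `K`.
HONEST LABEL: HC_CM is proved only modulo the 7 printed citations (2 remaining named inputs: hLiu418 = `stmt-HodgeConjecture-24832`, h413 = `stmt-HodgeConjecture-24833`) until
rung 0 closes; count-neutral group-theoretic bookkeeping.

## References
* [Rogawski1990] J. D. Rogawski, *Automorphic Representations of Unitary Groups in Three Variables*, Ann. of Math. Stud. 123 (1990), §8.2 p. 122, §4.12, §4.8 Case (a) p. 53.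
* [Knapp1986] A. W. Knapp, *Representation Theory of Semisimple Groups* (1986), Ch. V §3.
* [PlatonovRapinchuk1994] V. Platonov, A. Rapinchuk, *Algebraic Groups and Number Theory* (1994), §2.3.
-/

set_option autoImplicit false

noncomputable section

open NumberField NumberField.InfinitePlace Matrix Complex Topology
open Literature.NumberTheory.Rogawski1990 Literature.LinearAlgebra.Matrix
open scoped MatrixGroups Matrix ComplexConjugate Classical

namespace Literature.NumberTheory.Automorphic.UnitaryGroup

section TwoWall

variable (L : Type) [Field L] [NumberField L] [IsCMField L] (α : Fin 3 → L)
  (S' : Finset {w : InfinitePlace L // IsComplex w}) (w₁ w₂ : {w : InfinitePlace L // IsComplex w})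

set_option maxHeartbeats 1600000 in
/-- **(X2-M) TWO-PLACE (M-UNFOLD), explicit form.**  For a chart point `p` with walls `e^{ip_{w_i,0}} = e^{ip_{w_i,2}} ≠ e^{ip_{w_i,1}}` at two places
`w₁ ≠ w₂` outside the admissible `S′` and regular elsewhere: a closed commutative `K ≤ Z(γ_p)` inside the chart torus and an isomorphism of topological groups
`e : Z(γ_p) ≃ₜ* (B₁ × B₂) × K` with the bookkeeping clauses [4] [5]₁ [5]₂ [6] [7] [8]₁ [8]₂ [9]₁ [9]₂ [10] of the module docstring.
[cite: Rogawski1990, §8.2 p. 122; §4.12 Lemma 4.12.1 p. 66; §4.8 p. 53] [cite: Knapp1986, Ch. V §3] -/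
theorem exists_continuousMulEquiv_centralizer_gprimeTorus_twoWall_explicit (hα : ∀ i, α i ≠ 0) (hS' : ∀ w, w ∈ S' → w ∈ splitChartPlaces L α)
    (hw₁ : w₁ ∉ S') (hw₂ : w₂ ∉ S') (h12 : w₁ ≠ w₂) (p : {w : InfinitePlace L // IsComplex w} → Fin 3 → ℝ)
    (h02₁ : Circle.exp (p w₁ 0) = Circle.exp (p w₁ 2)) (h01₁ : Circle.exp (p w₁ 0) ≠ Circle.exp (p w₁ 1))
    (h02₂ : Circle.exp (p w₂ 0) = Circle.exp (p w₂ 2)) (h01₂ : Circle.exp (p w₂ 0) ≠ Circle.exp (p w₂ 1))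
    (hreg : ∀ w, w ≠ w₁ → w ≠ w₂ → w ∉ S' → Function.Injective fun i : Fin 3 => Circle.exp (p w i)) (hregS : ∀ w, w ∈ S' → p w 0 ≠ 0) :
    ∃ (K : Subgroup ↥(Subgroup.centralizer ({gprimeTorus L α S' p} : Set ↥(arch (↥(maximalRealSubfield L)) L (IsCMField.complexConj L) 3 (Matrix.diagonal α)))))
      (e : ↥(Subgroup.centralizer ({gprimeTorus L α S' p} : Set ↥(arch (↥(maximalRealSubfield L)) L (IsCMField.complexConj L) 3 (Matrix.diagonal α)))) ≃ₜ* (↥(unitaryGroupOfForm (starRingEnd ℂ) ((Matrix.diagonal ![α (lineOf (formSign L α w₁) 0), α (lineOf (formSign L α w₁) 2)]).map w₁.1.embedding)) × ↥(unitaryGroupOfForm (starRingEnd ℂ) ((Matrix.diagonal ![α (lineOf (formSign L α w₂) 0), α (lineOf (formSign L α w₂) 2)]).map w₂.1.embedding))) × ↥K),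
      IsClosed (K : Set ↥(Subgroup.centralizer ({gprimeTorus L α S' p} : Set ↥(arch (↥(maximalRealSubfield L)) L (IsCMField.complexConj L) 3 (Matrix.diagonal α))))) ∧
      (∀ k : ↥(Subgroup.centralizer ({gprimeTorus L α S' p} : Set ↥(arch (↥(maximalRealSubfield L)) L (IsCMField.complexConj L) 3 (Matrix.diagonal α)))), k ∈ K → (k : ↥(arch (↥(maximalRealSubfield L)) L (IsCMField.complexConj L) 3 (Matrix.diagonal α))) ∈ chartTorusG L α S') ∧
      (∀ k₁, k₁ ∈ K → ∀ k₂, k₂ ∈ K → k₁ * k₂ = k₂ * k₁) ∧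
      -- [4] the chart torus, read through the two block projections
      (∀ g : ↥(Subgroup.centralizer ({gprimeTorus L α S' p} : Set ↥(arch (↥(maximalRealSubfield L)) L (IsCMField.complexConj L) 3 (Matrix.diagonal α)))), (g : ↥(arch (↥(maximalRealSubfield L)) L (IsCMField.complexConj L) 3 (Matrix.diagonal α))) ∈ chartTorusG L α S' ↔
        (((e g).1.1 : ↥(unitaryGroupOfForm (starRingEnd ℂ) ((Matrix.diagonal ![α (lineOf (formSign L α w₁) 0), α (lineOf (formSign L α w₁) 2)]).map w₁.1.embedding))) : GL (Fin 2) ℂ) ∈ Set.range (circleDiagonal 2) ∧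
        (((e g).1.2 : ↥(unitaryGroupOfForm (starRingEnd ℂ) ((Matrix.diagonal ![α (lineOf (formSign L α w₂) 0), α (lineOf (formSign L α w₂) 2)]).map w₂.1.embedding))) : GL (Fin 2) ℂ) ∈ Set.range (circleDiagonal 2)) ∧
      -- [5]₁ [5]₂ the two blocks of a chart point
      (∀ c : {w : InfinitePlace L // IsComplex w} → Fin 3 → ℝ,
        (((e ⟨gprimeTorus L α S' c, gprimeTorus_mem_centralizer L α S' p c⟩).1.1 : ↥(unitaryGroupOfForm (starRingEnd ℂ) ((Matrix.diagonal ![α (lineOf (formSign L α w₁) 0), α (lineOf (formSign L α w₁) 2)]).map w₁.1.embedding))) : GL (Fin 2) ℂ) =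
          circleDiagonal 2 ![Circle.exp (c w₁ 0), Circle.exp (c w₁ 2)]) ∧
      (∀ c : {w : InfinitePlace L // IsComplex w} → Fin 3 → ℝ,
        (((e ⟨gprimeTorus L α S' c, gprimeTorus_mem_centralizer L α S' p c⟩).1.2 : ↥(unitaryGroupOfForm (starRingEnd ℂ) ((Matrix.diagonal ![α (lineOf (formSign L α w₂) 0), α (lineOf (formSign L α w₂) 2)]).map w₂.1.embedding))) : GL (Fin 2) ℂ) =
          circleDiagonal 2 ![Circle.exp (c w₂ 0), Circle.exp (c w₂ 2)]) ∧
      -- [6] the `K`-component of a chart point is the chart point at the double tangential point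
      (∀ c : {w : InfinitePlace L // IsComplex w} → Fin 3 → ℝ,
        ((((e ⟨gprimeTorus L α S' c, gprimeTorus_mem_centralizer L α S' p c⟩).2 : ↥K) : ↥(Subgroup.centralizer ({gprimeTorus L α S' p} : Set ↥(arch (↥(maximalRealSubfield L)) L (IsCMField.complexConj L) 3 (Matrix.diagonal α))))) : ↥(arch (↥(maximalRealSubfield L)) L (IsCMField.complexConj L) 3 (Matrix.diagonal α))) =
          gprimeTorus L α S' (Function.update (Function.update c w₁ ![0, c w₁ 1, 0]) w₂ ![0, c w₂ 1, 0])) ∧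
      -- [7] `e(T′) = (A₁ × A₂) × ⊤`
      Subgroup.map (e : ↥(Subgroup.centralizer ({gprimeTorus L α S' p} : Set ↥(arch (↥(maximalRealSubfield L)) L (IsCMField.complexConj L) 3 (Matrix.diagonal α)))) →* (↥(unitaryGroupOfForm (starRingEnd ℂ) ((Matrix.diagonal ![α (lineOf (formSign L α w₁) 0), α (lineOf (formSign L α w₁) 2)]).map w₁.1.embedding)) × ↥(unitaryGroupOfForm (starRingEnd ℂ) ((Matrix.diagonal ![α (lineOf (formSign L α w₂) 0), α (lineOf (formSign L α w₂) 2)]).map w₂.1.embedding))) × ↥K)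
        ((chartTorusG L α S').subgroupOf (Subgroup.centralizer ({gprimeTorus L α S' p} : Set ↥(arch (↥(maximalRealSubfield L)) L (IsCMField.complexConj L) 3 (Matrix.diagonal α))))) =
        (((((circleDiagonal 2).codRestrict (unitaryGroupOfForm (starRingEnd ℂ) ((Matrix.diagonal ![α (lineOf (formSign L α w₁) 0), α (lineOf (formSign L α w₁) 2)]).map w₁.1.embedding))
            (circleDiagonal_mem_archLocal_diagonal L 2 ![α (lineOf (formSign L α w₁) 0), α (lineOf (formSign L α w₁) 2)] w₁)).range)).prod
          ((((circleDiagonal 2).codRestrict (unitaryGroupOfForm (starRingEnd ℂ) ((Matrix.diagonal ![α (lineOf (formSign L α w₂) 0), α (lineOf (formSign L α w₂) 2)]).map w₂.1.embedding))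
            (circleDiagonal_mem_archLocal_diagonal L 2 ![α (lineOf (formSign L α w₂) 0), α (lineOf (formSign L α w₂) 2)] w₂)).range))).prod ⊤ ∧
      -- [8]₁ [8]₂ the inverse on `(B₁ × 1) × 1` ∕ `(1 × B₂) × 1` is the block embedding at `w₁` ∕ `w₂` (so `e⁻¹((b₁, b₂), 1)` is their product)
      (∀ b₁ : ↥(unitaryGroupOfForm (starRingEnd ℂ) ((Matrix.diagonal ![α (lineOf (formSign L α w₁) 0), α (lineOf (formSign L α w₁) 2)]).map w₁.1.embedding)),
        ((e.symm ((b₁, 1), 1) : ↥(Subgroup.centralizer ({gprimeTorus L α S' p} : Set ↥(arch (↥(maximalRealSubfield L)) L (IsCMField.complexConj L) 3 (Matrix.diagonal α))))) : ↥(arch (↥(maximalRealSubfield L)) L (IsCMField.complexConj L) 3 (Matrix.diagonal α))) =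
          (archPiEquivCM 3 L (Matrix.diagonal α)).symm (Pi.mulSingle w₁
            ((ContinuousMulEquiv.restrictSubgroup
            (GLn.conjEquiv (Matrix.GeneralLinearGroup.mkOfDetNeZero _ (det_monomial_one_ne_zero 3 (lineOf (formSign L α w₁)))))
            (archLocal L 3 (Matrix.diagonal (α ∘ (lineOf (formSign L α w₁)))) w₁) (archLocal L 3 (Matrix.diagonal α) w₁)
            (mem_archLocal_comp_perm_iff_conj_mem L 3 α w₁ (lineOf (formSign L α w₁))))
              ((endoEmb (starRingEnd ℂ) ((Matrix.diagonal ![(α ∘ (lineOf (formSign L α w₁))) 0, (α ∘ (lineOf (formSign L α w₁))) 2]).map w₁.1.embedding)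
              ((Matrix.diagonal ![(α ∘ (lineOf (formSign L α w₁))) 1]).map w₁.1.embedding) ((Matrix.diagonal (α ∘ (lineOf (formSign L α w₁)))).map w₁.1.embedding)
              (endoForm_archLocal_diagonal L (α ∘ (lineOf (formSign L α w₁))) w₁)) (b₁, 1))))) ∧
      (∀ b₂ : ↥(unitaryGroupOfForm (starRingEnd ℂ) ((Matrix.diagonal ![α (lineOf (formSign L α w₂) 0), α (lineOf (formSign L α w₂) 2)]).map w₂.1.embedding)),
        ((e.symm ((1, b₂), 1) : ↥(Subgroup.centralizer ({gprimeTorus L α S' p} : Set ↥(arch (↥(maximalRealSubfield L)) L (IsCMField.complexConj L) 3 (Matrix.diagonal α))))) : ↥(arch (↥(maximalRealSubfield L)) L (IsCMField.complexConj L) 3 (Matrix.diagonal α))) =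
          (archPiEquivCM 3 L (Matrix.diagonal α)).symm (Pi.mulSingle w₂
            ((ContinuousMulEquiv.restrictSubgroup
            (GLn.conjEquiv (Matrix.GeneralLinearGroup.mkOfDetNeZero _ (det_monomial_one_ne_zero 3 (lineOf (formSign L α w₂)))))
            (archLocal L 3 (Matrix.diagonal (α ∘ (lineOf (formSign L α w₂)))) w₂) (archLocal L 3 (Matrix.diagonal α) w₂)
            (mem_archLocal_comp_perm_iff_conj_mem L 3 α w₂ (lineOf (formSign L α w₂))))
              ((endoEmb (starRingEnd ℂ) ((Matrix.diagonal ![(α ∘ (lineOf (formSign L α w₂))) 0, (α ∘ (lineOf (formSign L α w₂))) 2]).map w₂.1.embedding)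
              ((Matrix.diagonal ![(α ∘ (lineOf (formSign L α w₂))) 1]).map w₂.1.embedding) ((Matrix.diagonal (α ∘ (lineOf (formSign L α w₂)))).map w₂.1.embedding)
              (endoForm_archLocal_diagonal L (α ∘ (lineOf (formSign L α w₂))) w₂)) (b₂, 1))))) ∧
      -- [9]₁ [9]₂ the `w_i`-components of `g ∈ M′`
      (∀ g : ↥(Subgroup.centralizer ({gprimeTorus L α S' p} : Set ↥(arch (↥(maximalRealSubfield L)) L (IsCMField.complexConj L) 3 (Matrix.diagonal α)))), ∃ u : ↥(unitaryGroupOfForm (starRingEnd ℂ) ((Matrix.diagonal ![(α ∘ (lineOf (formSign L α w₁))) 1]).map w₁.1.embedding)),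
        archPiEquivCM 3 L (Matrix.diagonal α) (g : ↥(arch (↥(maximalRealSubfield L)) L (IsCMField.complexConj L) 3 (Matrix.diagonal α))) w₁ =
          ((ContinuousMulEquiv.restrictSubgroup
            (GLn.conjEquiv (Matrix.GeneralLinearGroup.mkOfDetNeZero _ (det_monomial_one_ne_zero 3 (lineOf (formSign L α w₁)))))
            (archLocal L 3 (Matrix.diagonal (α ∘ (lineOf (formSign L α w₁)))) w₁) (archLocal L 3 (Matrix.diagonal α) w₁)
            (mem_archLocal_comp_perm_iff_conj_mem L 3 α w₁ (lineOf (formSign L α w₁))))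
              ((endoEmb (starRingEnd ℂ) ((Matrix.diagonal ![(α ∘ (lineOf (formSign L α w₁))) 0, (α ∘ (lineOf (formSign L α w₁))) 2]).map w₁.1.embedding)
              ((Matrix.diagonal ![(α ∘ (lineOf (formSign L α w₁))) 1]).map w₁.1.embedding) ((Matrix.diagonal (α ∘ (lineOf (formSign L α w₁)))).map w₁.1.embedding)
              (endoForm_archLocal_diagonal L (α ∘ (lineOf (formSign L α w₁))) w₁)) ((e g).1.1, u)))) ∧
      (∀ g : ↥(Subgroup.centralizer ({gprimeTorus L α S' p} : Set ↥(arch (↥(maximalRealSubfield L)) L (IsCMField.complexConj L) 3 (Matrix.diagonal α)))), ∃ u : ↥(unitaryGroupOfForm (starRingEnd ℂ) ((Matrix.diagonal ![(α ∘ (lineOf (formSign L α w₂))) 1]).map w₂.1.embedding)),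
        archPiEquivCM 3 L (Matrix.diagonal α) (g : ↥(arch (↥(maximalRealSubfield L)) L (IsCMField.complexConj L) 3 (Matrix.diagonal α))) w₂ =
          ((ContinuousMulEquiv.restrictSubgroup
            (GLn.conjEquiv (Matrix.GeneralLinearGroup.mkOfDetNeZero _ (det_monomial_one_ne_zero 3 (lineOf (formSign L α w₂)))))
            (archLocal L 3 (Matrix.diagonal (α ∘ (lineOf (formSign L α w₂)))) w₂) (archLocal L 3 (Matrix.diagonal α) w₂)
            (mem_archLocal_comp_perm_iff_conj_mem L 3 α w₂ (lineOf (formSign L α w₂))))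
              ((endoEmb (starRingEnd ℂ) ((Matrix.diagonal ![(α ∘ (lineOf (formSign L α w₂))) 0, (α ∘ (lineOf (formSign L α w₂))) 2]).map w₂.1.embedding)
              ((Matrix.diagonal ![(α ∘ (lineOf (formSign L α w₂))) 1]).map w₂.1.embedding) ((Matrix.diagonal (α ∘ (lineOf (formSign L α w₂)))).map w₂.1.embedding)
              (endoForm_archLocal_diagonal L (α ∘ (lineOf (formSign L α w₂))) w₂)) ((e g).1.2, u)))) ∧
      -- [10] `e` is the identity on `K`
      (∀ k : ↥(Subgroup.centralizer ({gprimeTorus L α S' p} : Set ↥(arch (↥(maximalRealSubfield L)) L (IsCMField.complexConj L) 3 (Matrix.diagonal α)))), ∀ hk : k ∈ K, e k = (1, ⟨k, hk⟩)) := by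
  classical
  -- §A  Notation (two places).
  let G := ↥(arch (↥(maximalRealSubfield L)) L (IsCMField.complexConj L) 3 (Matrix.diagonal α))
  let Φ := archPiEquivCM 3 L (Matrix.diagonal α)
  let M' : Subgroup G := Subgroup.centralizer ({gprimeTorus L α S' p} : Set G)
  -- place `w₁`
  let τ1 : Fin 3 ≃ Fin 3 := lineOf (formSign L α w₁)
  let eτ1 : ↥(unitaryGroupOfForm (starRingEnd ℂ) ((Matrix.diagonal (α ∘ τ1)).map w₁.1.embedding)) ≃ₜ* ↥(archLocal L 3 (Matrix.diagonal α) w₁) :=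
    ContinuousMulEquiv.restrictSubgroup (GLn.conjEquiv (Matrix.GeneralLinearGroup.mkOfDetNeZero _ (det_monomial_one_ne_zero 3 τ1)))
      (archLocal L 3 (Matrix.diagonal (α ∘ τ1)) w₁) (archLocal L 3 (Matrix.diagonal α) w₁) (mem_archLocal_comp_perm_iff_conj_mem L 3 α w₁ τ1)
  let z1 : Fin 3 → Circle := fun k => Circle.exp (p w₁ k)
  let d1 : ↥(unitaryGroupOfForm (starRingEnd ℂ) ((Matrix.diagonal (α ∘ τ1)).map w₁.1.embedding)) :=
    ⟨circleDiagonal 3 z1, circleDiagonal_mem_archLocal_diagonal L 3 (α ∘ τ1) w₁ z1⟩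
  let ι1 := endoEmb (starRingEnd ℂ) ((Matrix.diagonal ![(α ∘ τ1) 0, (α ∘ τ1) 2]).map w₁.1.embedding) ((Matrix.diagonal ![(α ∘ τ1) 1]).map w₁.1.embedding)
      ((Matrix.diagonal (α ∘ τ1)).map w₁.1.embedding) (endoForm_archLocal_diagonal L (α ∘ τ1) w₁)
  have hz102 : z1 0 = z1 2 := h02₁
  have hz101 : z1 0 ≠ z1 1 := h01₁
  obtain ⟨e91, he91⟩ := exists_centralizer_continuousMulEquiv_of_splitSingular L (α ∘ τ1) w₁ (z := z1) hz102 hz101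
  have hwall1 : gprimeBlock L α w₁ S' p = eτ1 d1 := by exact gprimeBlock_eq_relabel_circleDiagonal L α hw₁ p
  have hblk1 : ∀ c : {w : InfinitePlace L // IsComplex w} → Fin 3 → ℝ,
      gprimeBlock L α w₁ S' c = eτ1 ⟨circleDiagonal 3 (fun k => Circle.exp (c w₁ k)), circleDiagonal_mem_archLocal_diagonal L 3 (α ∘ τ1) w₁ _⟩ :=
    fun c => by exact gprimeBlock_eq_relabel_circleDiagonal L α hw₁ c
  have hd1ι : d1 = ι1 (⟨circleDiagonal 2 ![z1 0, z1 2], (circleDiagonal_blocks_mem L (α ∘ τ1) w₁ z1).1⟩, ⟨circleDiagonal 1 ![z1 1], (circleDiagonal_blocks_mem L (α ∘ τ1) w₁ z1).2⟩) :=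
    circleDiagonal_eq_endoEmb L (α ∘ τ1) w₁ z1
  -- §B  the local component at `w₁` and the block projection `π1`
  let ψ1 : ↥M' →* ↥(unitaryGroupOfForm (starRingEnd ℂ) ((Matrix.diagonal (α ∘ τ1)).map w₁.1.embedding)) :=
    (eτ1.symm : ↥(archLocal L 3 (Matrix.diagonal α) w₁) →* ↥(unitaryGroupOfForm (starRingEnd ℂ) ((Matrix.diagonal (α ∘ τ1)).map w₁.1.embedding))).comp
      ((Pi.evalMonoidHom (fun w : {w : InfinitePlace L // IsComplex w} => ↥(archLocal L 3 (Matrix.diagonal α) w)) w₁).comp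
        ((Φ : G →* _).comp M'.subtype))
  have hψ1_apply : ∀ g : ↥M', ψ1 g = eτ1.symm (Φ (g : G) w₁) := fun g => rfl
  have hψ1_mem : ∀ g : ↥M', ψ1 g ∈ Subgroup.centralizer ({d1} : Set ↥(unitaryGroupOfForm (starRingEnd ℂ) ((Matrix.diagonal (α ∘ τ1)).map w₁.1.embedding))) := by
    intro g
    rw [Subgroup.mem_centralizer_singleton_iff, hψ1_apply]
    have hg : (g : G) * gprimeTorus L α S' p = gprimeTorus L α S' p * g := (Subgroup.mem_centralizer_singleton_iff.1 g.2)
    have hg₀ := (commute_gprimeTorus_iff_forall L α S' p (g : G)).1 hg w₁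
    rw [hwall1] at hg₀
    have h := congrArg eτ1.symm hg₀
    simpa only [map_mul, ContinuousMulEquiv.symm_apply_apply] using h
  let ψ1' : ↥M' →* ↥(Subgroup.centralizer ({d1} : Set ↥(unitaryGroupOfForm (starRingEnd ℂ) ((Matrix.diagonal (α ∘ τ1)).map w₁.1.embedding)))) :=
    ψ1.codRestrict _ hψ1_mem
  let π1 : ↥M' →* ↥(unitaryGroupOfForm (starRingEnd ℂ) ((Matrix.diagonal ![(α ∘ τ1) 0, (α ∘ τ1) 2]).map w₁.1.embedding)) × ↥(unitaryGroupOfForm (starRingEnd ℂ) ((Matrix.diagonal ![(α ∘ τ1) 1]).map w₁.1.embedding)) := (e91 : _ →* _).comp ψ1'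
  let π1B := (MonoidHom.fst _ _).comp π1
  have hπ1B_apply : ∀ g : ↥M', π1B g = (π1 g).1 := fun _ => rfl
  have hιπ1 : ∀ g : ↥M', ι1 (π1 g) = ψ1 g := by
    intro g
    have h1 : ((e91.symm (π1 g) : ↥(Subgroup.centralizer ({d1} : Set _))) : ↥(unitaryGroupOfForm (starRingEnd ℂ) ((Matrix.diagonal (α ∘ τ1)).map w₁.1.embedding))) = ι1 (π1 g) :=
      he91 (π1 g)
    rw [← h1]
    show ((e91.symm (e91 (ψ1' g)) : ↥(Subgroup.centralizer ({d1} : Set _))) : _) = ψ1 g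
    rw [ContinuousMulEquiv.symm_apply_apply]
    rfl
  have hcomp1 : ∀ g : ↥M', Φ (g : G) w₁ = eτ1 (ι1 (π1 g)) := by
    intro g
    rw [hιπ1, hψ1_apply, ContinuousMulEquiv.apply_symm_apply]
  -- §C  the block embedding `sB1 : B_1 →* M′`
  let j1 : ↥(unitaryGroupOfForm (starRingEnd ℂ) ((Matrix.diagonal ![(α ∘ τ1) 0, (α ∘ τ1) 2]).map w₁.1.embedding)) →* G :=
    (Φ.symm : _ →* G).comp
      ((MonoidHom.mulSingle (fun w : {w : InfinitePlace L // IsComplex w} => ↥(archLocal L 3 (Matrix.diagonal α) w)) w₁).comp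
        ((eτ1 : ↥(unitaryGroupOfForm (starRingEnd ℂ) ((Matrix.diagonal (α ∘ τ1)).map w₁.1.embedding)) →* ↥(archLocal L 3 (Matrix.diagonal α) w₁)).comp
          (ι1.comp (MonoidHom.inl _ _))))
  have hj1_apply : ∀ b, Φ (j1 b) = Pi.mulSingle w₁ (eτ1 (ι1 (b, 1))) := by
    intro b
    show Φ (Φ.symm (Pi.mulSingle w₁ (eτ1 (ι1 (b, 1))))) = _
    rw [ContinuousMulEquiv.apply_symm_apply]
  have hj1_w : ∀ b, Φ (j1 b) w₁ = eτ1 (ι1 (b, 1)) := by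
    intro b; rw [hj1_apply, Pi.mulSingle_eq_same]
  have hj1_ne : ∀ b, ∀ w, w ≠ w₁ → Φ (j1 b) w = 1 := by
    intro b w hw; rw [hj1_apply, Pi.mulSingle_eq_of_ne hw]
  have hb_comm1 : ∀ b : ↥(unitaryGroupOfForm (starRingEnd ℂ) ((Matrix.diagonal ![(α ∘ τ1) 0, (α ∘ τ1) 2]).map w₁.1.embedding)), ι1 (b, 1) * d1 = d1 * ι1 (b, 1) := by
    intro b
    rw [hd1ι, ← map_mul, ← map_mul, Prod.mk_mul_mk, Prod.mk_mul_mk, one_mul, mul_one]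
    congr 2
    apply Subtype.ext
    exact circleDiagonal_two_comm_of_eq (u := ![z1 0, z1 2]) (by exact hz102) (b : GL (Fin 2) ℂ)
  have hj1_mem : ∀ b, j1 b ∈ M' := by
    intro b
    rw [Subgroup.mem_centralizer_singleton_iff]
    refine (commute_gprimeTorus_iff_forall L α S' p (j1 b)).2 fun w => ?_
    by_cases hw : w = w₁
    · rw [hw, hj1_w, hwall1, ← map_mul, ← map_mul, hb_comm1]
    · rw [hj1_ne b w hw, one_mul, mul_one]
  let sB1 : ↥(unitaryGroupOfForm (starRingEnd ℂ) ((Matrix.diagonal ![(α ∘ τ1) 0, (α ∘ τ1) 2]).map w₁.1.embedding)) →* ↥M' := j1.codRestrict M' hj1_mem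
  have hsB1_coe : ∀ b, ((sB1 b : ↥M') : G) = j1 b := fun b => rfl
  have hπsB1 : ∀ b, π1 (sB1 b) = (b, 1) := by
    intro b
    apply e91.symm.injective
    apply Subtype.ext
    rw [he91 (b, 1)]
    show ((e91.symm (e91 (ψ1' (sB1 b))) : ↥(Subgroup.centralizer ({d1} : Set _))) : _) = ι1 (b, 1)
    rw [ContinuousMulEquiv.symm_apply_apply]
    show ψ1 (sB1 b) = ι1 (b, 1)
    rw [hψ1_apply, hsB1_coe, hj1_w, ContinuousMulEquiv.symm_apply_apply]
  have hπ1BsB1 : ∀ b, π1B (sB1 b) = b := by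
    intro b; rw [hπ1B_apply, hπsB1]
  have hπ1B_cont : Continuous π1B := by
    have h1 : Continuous ψ1 := by
      show Continuous fun g : ↥M' => eτ1.symm (Φ (g : G) w₁)
      exact eτ1.symm.continuous.comp ((continuous_apply w₁).comp (Φ.continuous.comp continuous_subtype_val))
    have h2 : Continuous ψ1' := h1.subtype_mk _
    exact continuous_fst.comp (e91.continuous.comp h2)
  have hsB1_cont : Continuous sB1 := by
    have h1 : Continuous j1 := by
      show Continuous fun b => Φ.symm (Pi.mulSingle w₁ (eτ1 (ι1 (b, 1))))
      exact Φ.symm.continuous.comp ((_root_.continuous_mulSingle w₁).comp (eτ1.continuous.comp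
        ((continuous_endoEmb (starRingEnd ℂ) (endoForm_archLocal_diagonal L (α ∘ τ1) w₁)).comp (continuous_id.prodMk continuous_const))))
    exact h1.subtype_mk _
  -- the block of a chart point at `w₁`
  have hΦγ1 : ∀ c w, Φ (gprimeTorus L α S' c) w = gprimeBlock L α w S' c := fun c w => archPiEquivCM_gprimeTorus L α S' c w
  have htorus1 : ∀ c, π1 ⟨gprimeTorus L α S' c, gprimeTorus_mem_centralizer L α S' p c⟩ =
      (⟨circleDiagonal 2 ![Circle.exp (c w₁ 0), Circle.exp (c w₁ 2)], (circleDiagonal_blocks_mem L (α ∘ τ1) w₁ (fun k => Circle.exp (c w₁ k))).1⟩,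
       ⟨circleDiagonal 1 ![Circle.exp (c w₁ 1)], (circleDiagonal_blocks_mem L (α ∘ τ1) w₁ (fun k => Circle.exp (c w₁ k))).2⟩) := by
    intro c
    apply e91.symm.injective
    apply Subtype.ext
    rw [he91, he91, hιπ1, hψ1_apply, ← circleDiagonal_eq_endoEmb L (α ∘ τ1) w₁ (fun k => Circle.exp (c w₁ k))]
    show eτ1.symm (Φ (gprimeTorus L α S' c) w₁) = _
    rw [hΦγ1, gprimeBlock_eq_relabel_circleDiagonal L α hw₁ c]
    exact ContinuousMulEquiv.symm_apply_apply eτ1 _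
  -- the `w₁`-component of `k` with trivial `B_1`-block is a chart component `(0, θ, 0)`
  have hKloc1 : ∀ k : ↥M', π1B k = 1 → ∃ cw : Fin 3 → ℝ, ((Φ (k : G) w₁ : ↥(archLocal L 3 (Matrix.diagonal α) w₁)) : GL (Fin 3) ℂ) =
      ((gprimeBlock L α w₁ S' (fun _ => cw) : ↥(archLocal L 3 (Matrix.diagonal α) w₁)) : GL (Fin 3) ℂ) := by
    intro k hk1
    obtain ⟨θ, hθ⟩ := exists_coe_eq_circleDiagonal_one_of_mem L (a := (α ∘ τ1) 1) (hα _) w₁ (π1 k).2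
    refine ⟨![0, θ, 0], ?_⟩
    have hk' : π1 k = (1, (π1 k).2) := Prod.ext (by rw [← hπ1B_apply]; exact hk1) rfl
    have hz : ι1 (1, (π1 k).2) =
        ⟨circleDiagonal 3 (fun i => Circle.exp ((![0, θ, 0] : Fin 3 → ℝ) i)), circleDiagonal_mem_archLocal_diagonal L 3 (α ∘ τ1) w₁ _⟩ := by
      rw [circleDiagonal_eq_endoEmb L (α ∘ τ1) w₁ (fun i => Circle.exp ((![0, θ, 0] : Fin 3 → ℝ) i))]
      congr 1
      refine Prod.ext (Subtype.ext ?_) (Subtype.ext ?_)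
      · show ((1 : ↥(unitaryGroupOfForm (starRingEnd ℂ) ((Matrix.diagonal ![(α ∘ τ1) 0, (α ∘ τ1) 2]).map w₁.1.embedding))) : GL (Fin 2) ℂ) =
          circleDiagonal 2 ![Circle.exp ((![0, θ, 0] : Fin 3 → ℝ) 0), Circle.exp ((![0, θ, 0] : Fin 3 → ℝ) 2)]
        have h0 : (![0, θ, 0] : Fin 3 → ℝ) 0 = 0 := rfl
        have h2 : (![0, θ, 0] : Fin 3 → ℝ) 2 = 0 := rfl
        rw [h0, h2, Circle.exp_zero]
        have h11 : (![(1 : Circle), 1] : Fin 2 → Circle) = 1 := by funext i; fin_cases i <;> rfl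
        rw [h11, map_one]
        rfl
      · show (((π1 k).2 : ↥(unitaryGroupOfForm (starRingEnd ℂ) ((Matrix.diagonal ![(α ∘ τ1) 1]).map w₁.1.embedding))) : GL (Fin 1) ℂ) = circleDiagonal 1 ![Circle.exp ((![0, θ, 0] : Fin 3 → ℝ) 1)]
        apply Units.ext
        rw [hθ, coe_circleDiagonal]
        ext i j
        fin_cases i; fin_cases j
        simp [Circle.coe_exp]
    rw [hcomp1 k, hk', hz]
    exact (congrArg Subtype.val (gprimeBlock_eq_relabel_circleDiagonal L α hw₁ (fun _ => (![0, θ, 0] : Fin 3 → ℝ)))).symm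
  -- the `w₁`-component of `j1 (π_B g)` for a unit-diagonal block is a chart component `(θ₀, 0, θ₁)`
  have hjloc1 : ∀ (b : ↥(unitaryGroupOfForm (starRingEnd ℂ) ((Matrix.diagonal ![(α ∘ τ1) 0, (α ∘ τ1) 2]).map w₁.1.embedding))) (u : Fin 2 → Circle), circleDiagonal 2 u = (b : GL (Fin 2) ℂ) →
      ∃ cw : Fin 3 → ℝ, ((Φ (j1 b) w₁ : ↥(archLocal L 3 (Matrix.diagonal α) w₁)) : GL (Fin 3) ℂ) =
        ((gprimeBlock L α w₁ S' (fun _ => cw) : ↥(archLocal L 3 (Matrix.diagonal α) w₁)) : GL (Fin 3) ℂ) := by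
    intro b u hu
    obtain ⟨θ₀, hθ₀⟩ := Circle.exp_surjective (u 0)
    obtain ⟨θ₁, hθ₁⟩ := Circle.exp_surjective (u 1)
    refine ⟨![θ₀, 0, θ₁], ?_⟩
    have hz : ι1 (b, 1) =
        ⟨circleDiagonal 3 (fun i => Circle.exp ((![θ₀, 0, θ₁] : Fin 3 → ℝ) i)), circleDiagonal_mem_archLocal_diagonal L 3 (α ∘ τ1) w₁ _⟩ := by
      rw [circleDiagonal_eq_endoEmb L (α ∘ τ1) w₁ (fun i => Circle.exp ((![θ₀, 0, θ₁] : Fin 3 → ℝ) i))]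
      congr 1
      refine Prod.ext (Subtype.ext ?_) (Subtype.ext ?_)
      · show ((b : ↥(unitaryGroupOfForm (starRingEnd ℂ) ((Matrix.diagonal ![(α ∘ τ1) 0, (α ∘ τ1) 2]).map w₁.1.embedding))) : GL (Fin 2) ℂ) =
          circleDiagonal 2 ![Circle.exp ((![θ₀, 0, θ₁] : Fin 3 → ℝ) 0), Circle.exp ((![θ₀, 0, θ₁] : Fin 3 → ℝ) 2)]
        rw [← hu]
        have h0 : (![θ₀, 0, θ₁] : Fin 3 → ℝ) 0 = θ₀ := rfl
        have h2 : (![θ₀, 0, θ₁] : Fin 3 → ℝ) 2 = θ₁ := rfl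
        rw [h0, h2, hθ₀, hθ₁]
        congr 1
        funext i; fin_cases i <;> rfl
      · show ((1 : ↥(unitaryGroupOfForm (starRingEnd ℂ) ((Matrix.diagonal ![(α ∘ τ1) 1]).map w₁.1.embedding))) : GL (Fin 1) ℂ) = circleDiagonal 1 ![Circle.exp ((![θ₀, 0, θ₁] : Fin 3 → ℝ) 1)]
        have h1 : (![θ₀, 0, θ₁] : Fin 3 → ℝ) 1 = 0 := rfl
        rw [h1, Circle.exp_zero]
        have h11 : (![(1 : Circle)] : Fin 1 → Circle) = 1 := by funext i; fin_cases i; rfl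
        rw [h11, map_one]
        rfl
    rw [hj1_w, hz]
    exact (congrArg Subtype.val (gprimeBlock_eq_relabel_circleDiagonal L α hw₁ (fun _ => (![θ₀, 0, θ₁] : Fin 3 → ℝ)))).symm
  -- place `w₂`
  let τ2 : Fin 3 ≃ Fin 3 := lineOf (formSign L α w₂)
  let eτ2 : ↥(unitaryGroupOfForm (starRingEnd ℂ) ((Matrix.diagonal (α ∘ τ2)).map w₂.1.embedding)) ≃ₜ* ↥(archLocal L 3 (Matrix.diagonal α) w₂) :=
    ContinuousMulEquiv.restrictSubgroup (GLn.conjEquiv (Matrix.GeneralLinearGroup.mkOfDetNeZero _ (det_monomial_one_ne_zero 3 τ2)))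
      (archLocal L 3 (Matrix.diagonal (α ∘ τ2)) w₂) (archLocal L 3 (Matrix.diagonal α) w₂) (mem_archLocal_comp_perm_iff_conj_mem L 3 α w₂ τ2)
  let z2 : Fin 3 → Circle := fun k => Circle.exp (p w₂ k)
  let d2 : ↥(unitaryGroupOfForm (starRingEnd ℂ) ((Matrix.diagonal (α ∘ τ2)).map w₂.1.embedding)) :=
    ⟨circleDiagonal 3 z2, circleDiagonal_mem_archLocal_diagonal L 3 (α ∘ τ2) w₂ z2⟩
  let ι2 := endoEmb (starRingEnd ℂ) ((Matrix.diagonal ![(α ∘ τ2) 0, (α ∘ τ2) 2]).map w₂.1.embedding) ((Matrix.diagonal ![(α ∘ τ2) 1]).map w₂.1.embedding)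
      ((Matrix.diagonal (α ∘ τ2)).map w₂.1.embedding) (endoForm_archLocal_diagonal L (α ∘ τ2) w₂)
  have hz202 : z2 0 = z2 2 := h02₂
  have hz201 : z2 0 ≠ z2 1 := h01₂
  obtain ⟨e92, he92⟩ := exists_centralizer_continuousMulEquiv_of_splitSingular L (α ∘ τ2) w₂ (z := z2) hz202 hz201
  have hwall2 : gprimeBlock L α w₂ S' p = eτ2 d2 := by exact gprimeBlock_eq_relabel_circleDiagonal L α hw₂ p
  have hblk2 : ∀ c : {w : InfinitePlace L // IsComplex w} → Fin 3 → ℝ,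
      gprimeBlock L α w₂ S' c = eτ2 ⟨circleDiagonal 3 (fun k => Circle.exp (c w₂ k)), circleDiagonal_mem_archLocal_diagonal L 3 (α ∘ τ2) w₂ _⟩ :=
    fun c => by exact gprimeBlock_eq_relabel_circleDiagonal L α hw₂ c
  have hd2ι : d2 = ι2 (⟨circleDiagonal 2 ![z2 0, z2 2], (circleDiagonal_blocks_mem L (α ∘ τ2) w₂ z2).1⟩, ⟨circleDiagonal 1 ![z2 1], (circleDiagonal_blocks_mem L (α ∘ τ2) w₂ z2).2⟩) :=
    circleDiagonal_eq_endoEmb L (α ∘ τ2) w₂ z2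
  -- §B  the local component at `w₂` and the block projection `π2`
  let ψ2 : ↥M' →* ↥(unitaryGroupOfForm (starRingEnd ℂ) ((Matrix.diagonal (α ∘ τ2)).map w₂.1.embedding)) :=
    (eτ2.symm : ↥(archLocal L 3 (Matrix.diagonal α) w₂) →* ↥(unitaryGroupOfForm (starRingEnd ℂ) ((Matrix.diagonal (α ∘ τ2)).map w₂.1.embedding))).comp
      ((Pi.evalMonoidHom (fun w : {w : InfinitePlace L // IsComplex w} => ↥(archLocal L 3 (Matrix.diagonal α) w)) w₂).comp
        ((Φ : G →* _).comp M'.subtype))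
  have hψ2_apply : ∀ g : ↥M', ψ2 g = eτ2.symm (Φ (g : G) w₂) := fun g => rfl
  have hψ2_mem : ∀ g : ↥M', ψ2 g ∈ Subgroup.centralizer ({d2} : Set ↥(unitaryGroupOfForm (starRingEnd ℂ) ((Matrix.diagonal (α ∘ τ2)).map w₂.1.embedding))) := by
    intro g
    rw [Subgroup.mem_centralizer_singleton_iff, hψ2_apply]
    have hg : (g : G) * gprimeTorus L α S' p = gprimeTorus L α S' p * g := (Subgroup.mem_centralizer_singleton_iff.1 g.2)
    have hg₀ := (commute_gprimeTorus_iff_forall L α S' p (g : G)).1 hg w₂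
    rw [hwall2] at hg₀
    have h := congrArg eτ2.symm hg₀
    simpa only [map_mul, ContinuousMulEquiv.symm_apply_apply] using h
  let ψ2' : ↥M' →* ↥(Subgroup.centralizer ({d2} : Set ↥(unitaryGroupOfForm (starRingEnd ℂ) ((Matrix.diagonal (α ∘ τ2)).map w₂.1.embedding)))) :=
    ψ2.codRestrict _ hψ2_mem
  let π2 : ↥M' →* ↥(unitaryGroupOfForm (starRingEnd ℂ) ((Matrix.diagonal ![(α ∘ τ2) 0, (α ∘ τ2) 2]).map w₂.1.embedding)) × ↥(unitaryGroupOfForm (starRingEnd ℂ) ((Matrix.diagonal ![(α ∘ τ2) 1]).map w₂.1.embedding)) := (e92 : _ →* _).comp ψ2'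
  let π2B := (MonoidHom.fst _ _).comp π2
  have hπ2B_apply : ∀ g : ↥M', π2B g = (π2 g).1 := fun _ => rfl
  have hιπ2 : ∀ g : ↥M', ι2 (π2 g) = ψ2 g := by
    intro g
    have h1 : ((e92.symm (π2 g) : ↥(Subgroup.centralizer ({d2} : Set _))) : ↥(unitaryGroupOfForm (starRingEnd ℂ) ((Matrix.diagonal (α ∘ τ2)).map w₂.1.embedding))) = ι2 (π2 g) :=
      he92 (π2 g)
    rw [← h1]
    show ((e92.symm (e92 (ψ2' g)) : ↥(Subgroup.centralizer ({d2} : Set _))) : _) = ψ2 g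
    rw [ContinuousMulEquiv.symm_apply_apply]
    rfl
  have hcomp2 : ∀ g : ↥M', Φ (g : G) w₂ = eτ2 (ι2 (π2 g)) := by
    intro g
    rw [hιπ2, hψ2_apply, ContinuousMulEquiv.apply_symm_apply]
  -- §C  the block embedding `sB2 : B_2 →* M′`
  let j2 : ↥(unitaryGroupOfForm (starRingEnd ℂ) ((Matrix.diagonal ![(α ∘ τ2) 0, (α ∘ τ2) 2]).map w₂.1.embedding)) →* G :=
    (Φ.symm : _ →* G).comp
      ((MonoidHom.mulSingle (fun w : {w : InfinitePlace L // IsComplex w} => ↥(archLocal L 3 (Matrix.diagonal α) w)) w₂).comp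
        ((eτ2 : ↥(unitaryGroupOfForm (starRingEnd ℂ) ((Matrix.diagonal (α ∘ τ2)).map w₂.1.embedding)) →* ↥(archLocal L 3 (Matrix.diagonal α) w₂)).comp
          (ι2.comp (MonoidHom.inl _ _))))
  have hj2_apply : ∀ b, Φ (j2 b) = Pi.mulSingle w₂ (eτ2 (ι2 (b, 1))) := by
    intro b
    show Φ (Φ.symm (Pi.mulSingle w₂ (eτ2 (ι2 (b, 1))))) = _
    rw [ContinuousMulEquiv.apply_symm_apply]
  have hj2_w : ∀ b, Φ (j2 b) w₂ = eτ2 (ι2 (b, 1)) := by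
    intro b; rw [hj2_apply, Pi.mulSingle_eq_same]
  have hj2_ne : ∀ b, ∀ w, w ≠ w₂ → Φ (j2 b) w = 1 := by
    intro b w hw; rw [hj2_apply, Pi.mulSingle_eq_of_ne hw]
  have hb_comm2 : ∀ b : ↥(unitaryGroupOfForm (starRingEnd ℂ) ((Matrix.diagonal ![(α ∘ τ2) 0, (α ∘ τ2) 2]).map w₂.1.embedding)), ι2 (b, 1) * d2 = d2 * ι2 (b, 1) := by
    intro b
    rw [hd2ι, ← map_mul, ← map_mul, Prod.mk_mul_mk, Prod.mk_mul_mk, one_mul, mul_one]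
    congr 2
    apply Subtype.ext
    exact circleDiagonal_two_comm_of_eq (u := ![z2 0, z2 2]) (by exact hz202) (b : GL (Fin 2) ℂ)
  have hj2_mem : ∀ b, j2 b ∈ M' := by
    intro b
    rw [Subgroup.mem_centralizer_singleton_iff]
    refine (commute_gprimeTorus_iff_forall L α S' p (j2 b)).2 fun w => ?_
    by_cases hw : w = w₂
    · rw [hw, hj2_w, hwall2, ← map_mul, ← map_mul, hb_comm2]
    · rw [hj2_ne b w hw, one_mul, mul_one]
  let sB2 : ↥(unitaryGroupOfForm (starRingEnd ℂ) ((Matrix.diagonal ![(α ∘ τ2) 0, (α ∘ τ2) 2]).map w₂.1.embedding)) →* ↥M' := j2.codRestrict M' hj2_mem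
  have hsB2_coe : ∀ b, ((sB2 b : ↥M') : G) = j2 b := fun b => rfl
  have hπsB2 : ∀ b, π2 (sB2 b) = (b, 1) := by
    intro b
    apply e92.symm.injective
    apply Subtype.ext
    rw [he92 (b, 1)]
    show ((e92.symm (e92 (ψ2' (sB2 b))) : ↥(Subgroup.centralizer ({d2} : Set _))) : _) = ι2 (b, 1)
    rw [ContinuousMulEquiv.symm_apply_apply]
    show ψ2 (sB2 b) = ι2 (b, 1)
    rw [hψ2_apply, hsB2_coe, hj2_w, ContinuousMulEquiv.symm_apply_apply]
  have hπ2BsB2 : ∀ b, π2B (sB2 b) = b := by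
    intro b; rw [hπ2B_apply, hπsB2]
  have hπ2B_cont : Continuous π2B := by
    have h1 : Continuous ψ2 := by
      show Continuous fun g : ↥M' => eτ2.symm (Φ (g : G) w₂)
      exact eτ2.symm.continuous.comp ((continuous_apply w₂).comp (Φ.continuous.comp continuous_subtype_val))
    have h2 : Continuous ψ2' := h1.subtype_mk _
    exact continuous_fst.comp (e92.continuous.comp h2)
  have hsB2_cont : Continuous sB2 := by
    have h1 : Continuous j2 := by
      show Continuous fun b => Φ.symm (Pi.mulSingle w₂ (eτ2 (ι2 (b, 1))))
      exact Φ.symm.continuous.comp ((_root_.continuous_mulSingle w₂).comp (eτ2.continuous.comp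
        ((continuous_endoEmb (starRingEnd ℂ) (endoForm_archLocal_diagonal L (α ∘ τ2) w₂)).comp (continuous_id.prodMk continuous_const))))
    exact h1.subtype_mk _
  -- the block of a chart point at `w₂`
  have hΦγ2 : ∀ c w, Φ (gprimeTorus L α S' c) w = gprimeBlock L α w S' c := fun c w => archPiEquivCM_gprimeTorus L α S' c w
  have htorus2 : ∀ c, π2 ⟨gprimeTorus L α S' c, gprimeTorus_mem_centralizer L α S' p c⟩ =
      (⟨circleDiagonal 2 ![Circle.exp (c w₂ 0), Circle.exp (c w₂ 2)], (circleDiagonal_blocks_mem L (α ∘ τ2) w₂ (fun k => Circle.exp (c w₂ k))).1⟩,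
       ⟨circleDiagonal 1 ![Circle.exp (c w₂ 1)], (circleDiagonal_blocks_mem L (α ∘ τ2) w₂ (fun k => Circle.exp (c w₂ k))).2⟩) := by
    intro c
    apply e92.symm.injective
    apply Subtype.ext
    rw [he92, he92, hιπ2, hψ2_apply, ← circleDiagonal_eq_endoEmb L (α ∘ τ2) w₂ (fun k => Circle.exp (c w₂ k))]
    show eτ2.symm (Φ (gprimeTorus L α S' c) w₂) = _
    rw [hΦγ2, gprimeBlock_eq_relabel_circleDiagonal L α hw₂ c]
    exact ContinuousMulEquiv.symm_apply_apply eτ2 _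
  -- the `w₂`-component of `k` with trivial `B_2`-block is a chart component `(0, θ, 0)`
  have hKloc2 : ∀ k : ↥M', π2B k = 1 → ∃ cw : Fin 3 → ℝ, ((Φ (k : G) w₂ : ↥(archLocal L 3 (Matrix.diagonal α) w₂)) : GL (Fin 3) ℂ) =
      ((gprimeBlock L α w₂ S' (fun _ => cw) : ↥(archLocal L 3 (Matrix.diagonal α) w₂)) : GL (Fin 3) ℂ) := by
    intro k hk1
    obtain ⟨θ, hθ⟩ := exists_coe_eq_circleDiagonal_one_of_mem L (a := (α ∘ τ2) 1) (hα _) w₂ (π2 k).2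
    refine ⟨![0, θ, 0], ?_⟩
    have hk' : π2 k = (1, (π2 k).2) := Prod.ext (by rw [← hπ2B_apply]; exact hk1) rfl
    have hz : ι2 (1, (π2 k).2) =
        ⟨circleDiagonal 3 (fun i => Circle.exp ((![0, θ, 0] : Fin 3 → ℝ) i)), circleDiagonal_mem_archLocal_diagonal L 3 (α ∘ τ2) w₂ _⟩ := by
      rw [circleDiagonal_eq_endoEmb L (α ∘ τ2) w₂ (fun i => Circle.exp ((![0, θ, 0] : Fin 3 → ℝ) i))]
      congr 1
      refine Prod.ext (Subtype.ext ?_) (Subtype.ext ?_)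
      · show ((1 : ↥(unitaryGroupOfForm (starRingEnd ℂ) ((Matrix.diagonal ![(α ∘ τ2) 0, (α ∘ τ2) 2]).map w₂.1.embedding))) : GL (Fin 2) ℂ) =
          circleDiagonal 2 ![Circle.exp ((![0, θ, 0] : Fin 3 → ℝ) 0), Circle.exp ((![0, θ, 0] : Fin 3 → ℝ) 2)]
        have h0 : (![0, θ, 0] : Fin 3 → ℝ) 0 = 0 := rfl
        have h2 : (![0, θ, 0] : Fin 3 → ℝ) 2 = 0 := rfl
        rw [h0, h2, Circle.exp_zero]
        have h11 : (![(1 : Circle), 1] : Fin 2 → Circle) = 1 := by funext i; fin_cases i <;> rfl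
        rw [h11, map_one]
        rfl
      · show (((π2 k).2 : ↥(unitaryGroupOfForm (starRingEnd ℂ) ((Matrix.diagonal ![(α ∘ τ2) 1]).map w₂.1.embedding))) : GL (Fin 1) ℂ) = circleDiagonal 1 ![Circle.exp ((![0, θ, 0] : Fin 3 → ℝ) 1)]
        apply Units.ext
        rw [hθ, coe_circleDiagonal]
        ext i j
        fin_cases i; fin_cases j
        simp [Circle.coe_exp]
    rw [hcomp2 k, hk', hz]
    exact (congrArg Subtype.val (gprimeBlock_eq_relabel_circleDiagonal L α hw₂ (fun _ => (![0, θ, 0] : Fin 3 → ℝ)))).symm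
  -- the `w₂`-component of `j2 (π_B g)` for a unit-diagonal block is a chart component `(θ₀, 0, θ₁)`
  have hjloc2 : ∀ (b : ↥(unitaryGroupOfForm (starRingEnd ℂ) ((Matrix.diagonal ![(α ∘ τ2) 0, (α ∘ τ2) 2]).map w₂.1.embedding))) (u : Fin 2 → Circle), circleDiagonal 2 u = (b : GL (Fin 2) ℂ) →
      ∃ cw : Fin 3 → ℝ, ((Φ (j2 b) w₂ : ↥(archLocal L 3 (Matrix.diagonal α) w₂)) : GL (Fin 3) ℂ) =
        ((gprimeBlock L α w₂ S' (fun _ => cw) : ↥(archLocal L 3 (Matrix.diagonal α) w₂)) : GL (Fin 3) ℂ) := by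
    intro b u hu
    obtain ⟨θ₀, hθ₀⟩ := Circle.exp_surjective (u 0)
    obtain ⟨θ₁, hθ₁⟩ := Circle.exp_surjective (u 1)
    refine ⟨![θ₀, 0, θ₁], ?_⟩
    have hz : ι2 (b, 1) =
        ⟨circleDiagonal 3 (fun i => Circle.exp ((![θ₀, 0, θ₁] : Fin 3 → ℝ) i)), circleDiagonal_mem_archLocal_diagonal L 3 (α ∘ τ2) w₂ _⟩ := by
      rw [circleDiagonal_eq_endoEmb L (α ∘ τ2) w₂ (fun i => Circle.exp ((![θ₀, 0, θ₁] : Fin 3 → ℝ) i))]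
      congr 1
      refine Prod.ext (Subtype.ext ?_) (Subtype.ext ?_)
      · show ((b : ↥(unitaryGroupOfForm (starRingEnd ℂ) ((Matrix.diagonal ![(α ∘ τ2) 0, (α ∘ τ2) 2]).map w₂.1.embedding))) : GL (Fin 2) ℂ) =
          circleDiagonal 2 ![Circle.exp ((![θ₀, 0, θ₁] : Fin 3 → ℝ) 0), Circle.exp ((![θ₀, 0, θ₁] : Fin 3 → ℝ) 2)]
        rw [← hu]
        have h0 : (![θ₀, 0, θ₁] : Fin 3 → ℝ) 0 = θ₀ := rfl
        have h2 : (![θ₀, 0, θ₁] : Fin 3 → ℝ) 2 = θ₁ := rfl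
        rw [h0, h2, hθ₀, hθ₁]
        congr 1
        funext i; fin_cases i <;> rfl
      · show ((1 : ↥(unitaryGroupOfForm (starRingEnd ℂ) ((Matrix.diagonal ![(α ∘ τ2) 1]).map w₂.1.embedding))) : GL (Fin 1) ℂ) = circleDiagonal 1 ![Circle.exp ((![θ₀, 0, θ₁] : Fin 3 → ℝ) 1)]
        have h1 : (![θ₀, 0, θ₁] : Fin 3 → ℝ) 1 = 0 := rfl
        rw [h1, Circle.exp_zero]
        have h11 : (![(1 : Circle)] : Fin 1 → Circle) = 1 := by funext i; fin_cases i; rfl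
        rw [h11, map_one]
        rfl
    rw [hj2_w, hz]
    exact (congrArg Subtype.val (gprimeBlock_eq_relabel_circleDiagonal L α hw₂ (fun _ => (![θ₀, 0, θ₁] : Fin 3 → ℝ)))).symm
  -- §D  cross-place facts: `π_{B_i} ∘ s_j = 1` (`i ≠ j`), the two embeddings commute, and `s_i(b)` commutes with `ker (π_{B₁}, π_{B₂})`
  have hπ1BsB2 : ∀ b, π1B (sB2 b) = 1 := by
    intro b
    have h1 : ψ1 (sB2 b) = 1 := by rw [hψ1_apply, hsB2_coe, hj2_ne b w₁ h12, map_one]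
    have h2 : π1 (sB2 b) = 1 := by
      show e91 (ψ1' (sB2 b)) = 1
      have h3 : ψ1' (sB2 b) = 1 := Subtype.ext h1
      rw [h3, map_one]
    rw [hπ1B_apply, h2]; rfl
  have hπ2BsB1 : ∀ b, π2B (sB1 b) = 1 := by
    intro b
    have h1 : ψ2 (sB1 b) = 1 := by rw [hψ2_apply, hsB1_coe, hj1_ne b w₂ (Ne.symm h12), map_one]
    have h2 : π2 (sB1 b) = 1 := by
      show e92 (ψ2' (sB1 b)) = 1
      have h3 : ψ2' (sB1 b) = 1 := Subtype.ext h1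
      rw [h3, map_one]
    rw [hπ2B_apply, h2]; rfl
  have hs12 : ∀ b₁ b₂, Commute (sB1 b₁) (sB2 b₂) := by
    intro b₁ b₂
    apply Subtype.ext
    apply Φ.injective
    funext w
    show Φ (((sB1 b₁ : ↥M') : G) * ((sB2 b₂ : ↥M') : G)) w = Φ (((sB2 b₂ : ↥M') : G) * ((sB1 b₁ : ↥M') : G)) w
    rw [map_mul, map_mul, Pi.mul_apply, Pi.mul_apply, hsB1_coe, hsB2_coe]
    by_cases hw : w = w₁
    · rw [hw, hj2_ne b₂ w₁ h12, one_mul, mul_one]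
    · rw [hj1_ne b₁ w hw, one_mul, mul_one]
  -- the joint block projection and the joint block embedding
  let πB : ↥M' →* ↥(unitaryGroupOfForm (starRingEnd ℂ) ((Matrix.diagonal ![(α ∘ τ1) 0, (α ∘ τ1) 2]).map w₁.1.embedding)) × ↥(unitaryGroupOfForm (starRingEnd ℂ) ((Matrix.diagonal ![(α ∘ τ2) 0, (α ∘ τ2) 2]).map w₂.1.embedding)) := π1B.prod π2B
  have hπB_apply : ∀ g : ↥M', πB g = (π1B g, π2B g) := fun _ => rfl
  let sB : ↥(unitaryGroupOfForm (starRingEnd ℂ) ((Matrix.diagonal ![(α ∘ τ1) 0, (α ∘ τ1) 2]).map w₁.1.embedding)) × ↥(unitaryGroupOfForm (starRingEnd ℂ) ((Matrix.diagonal ![(α ∘ τ2) 0, (α ∘ τ2) 2]).map w₂.1.embedding)) →* ↥M' := MonoidHom.noncommCoprod sB1 sB2 hs12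
  have hsB_apply : ∀ q, sB q = sB1 q.1 * sB2 q.2 := fun _ => rfl
  have hπBsB : ∀ q, πB (sB q) = q := by
    intro q
    rw [hπB_apply, hsB_apply, map_mul, map_mul, hπ1BsB1, hπ1BsB2, hπ2BsB1, hπ2BsB2, mul_one, one_mul]
  have hcommK : ∀ q, ∀ k : ↥M', πB k = 1 → sB q * k = k * sB q := by
    intro q k hk
    have hk₁ : π1B k = 1 := by have h := congrArg Prod.fst hk; rw [hπB_apply] at h; exact h
    have hk₂ : π2B k = 1 := by have h := congrArg Prod.snd hk; rw [hπB_apply] at h; exact h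
    apply Subtype.ext
    apply Φ.injective
    funext w
    show Φ (((sB q : ↥M') : G) * (k : G)) w = Φ ((k : G) * ((sB q : ↥M') : G)) w
    rw [hsB_apply, Subgroup.coe_mul, hsB1_coe, hsB2_coe]
    simp only [map_mul, Pi.mul_apply]
    by_cases hw1 : w = w₁
    · subst hw1
      rw [hj1_w, hj2_ne _ _ h12, mul_one, hcomp1 k]
      have hk' : π1 k = (1, (π1 k).2) := Prod.ext (by rw [← hπ1B_apply]; exact hk₁) rfl
      have hc := (commute_endoEmb_inl_inr (starRingEnd ℂ) (endoForm_archLocal_diagonal L (α ∘ τ1) w) q.1 (π1 k).2).eq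
      rw [hk', ← map_mul eτ1, ← map_mul eτ1, hc]
    · by_cases hw2 : w = w₂
      · subst hw2
        rw [hj1_ne _ _ hw1, hj2_w, one_mul, hcomp2 k]
        have hk' : π2 k = (1, (π2 k).2) := Prod.ext (by rw [← hπ2B_apply]; exact hk₂) rfl
        have hc := (commute_endoEmb_inl_inr (starRingEnd ℂ) (endoForm_archLocal_diagonal L (α ∘ τ2) w) q.2 (π2 k).2).eq
        rw [hk', ← map_mul eτ2, ← map_mul eτ2, hc]
      · rw [hj1_ne _ w hw1, hj2_ne _ w hw2]
        simp only [one_mul, mul_one]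
  have hπB_cont : Continuous πB := hπ1B_cont.prodMk hπ2B_cont
  have hsB_cont : Continuous sB := by
    show Continuous fun q : ↥(unitaryGroupOfForm (starRingEnd ℂ) ((Matrix.diagonal ![(α ∘ τ1) 0, (α ∘ τ1) 2]).map w₁.1.embedding)) × ↥(unitaryGroupOfForm (starRingEnd ℂ) ((Matrix.diagonal ![(α ∘ τ2) 0, (α ∘ τ2) 2]).map w₂.1.embedding)) => sB1 q.1 * sB2 q.2
    exact (hsB1_cont.comp continuous_fst).mul (hsB2_cont.comp continuous_snd)
  -- §E  `K = ker π_B` and the isomorphism `e_M : M′ ≃ₜ* (B₁ × B₂) × K`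
  let K : Subgroup ↥M' := πB.ker
  have hK_mem : ∀ k : ↥M', k ∈ K ↔ πB k = 1 := fun k => MonoidHom.mem_ker
  have hsec : ∀ g : ↥M', (sB (πB g))⁻¹ * g ∈ K := by
    intro g; rw [hK_mem, map_mul, map_inv, hπBsB, inv_mul_cancel]
  let eM : ↥M' ≃* ((↥(unitaryGroupOfForm (starRingEnd ℂ) ((Matrix.diagonal ![(α ∘ τ1) 0, (α ∘ τ1) 2]).map w₁.1.embedding)) × ↥(unitaryGroupOfForm (starRingEnd ℂ) ((Matrix.diagonal ![(α ∘ τ2) 0, (α ∘ τ2) 2]).map w₂.1.embedding))) × ↥K) :=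
    { toFun := fun g => (πB g, ⟨(sB (πB g))⁻¹ * g, hsec g⟩)
      invFun := fun q => sB q.1 * (q.2 : ↥M')
      left_inv := fun g => mul_inv_cancel_left _ _
      right_inv := fun q => by
        have h1 : πB (sB q.1 * (q.2 : ↥M')) = q.1 := by rw [map_mul, hπBsB, (hK_mem _).1 q.2.2, mul_one]
        refine Prod.ext h1 (Subtype.ext ?_)
        show (sB (πB (sB q.1 * (q.2 : ↥M'))))⁻¹ * (sB q.1 * (q.2 : ↥M')) = (q.2 : ↥M')
        rw [h1, inv_mul_cancel_left]
      map_mul' := fun g h => by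
        refine Prod.ext (map_mul πB g h) (Subtype.ext ?_)
        show (sB (πB (g * h)))⁻¹ * (g * h) = ((sB (πB g))⁻¹ * g) * ((sB (πB h))⁻¹ * h)
        have hc : sB (πB h) * ((sB (πB g))⁻¹ * g) = ((sB (πB g))⁻¹ * g) * sB (πB h) := hcommK (πB h) _ ((hK_mem _).1 (hsec g))
        have hc' : (sB (πB h))⁻¹ * ((sB (πB g))⁻¹ * g) = ((sB (πB g))⁻¹ * g) * (sB (πB h))⁻¹ := by
          rw [inv_mul_eq_iff_eq_mul, ← mul_assoc, hc, mul_inv_cancel_right]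
        rw [map_mul, map_mul, _root_.mul_inv_rev]
        calc (sB (πB h))⁻¹ * (sB (πB g))⁻¹ * (g * h)
            = ((sB (πB h))⁻¹ * ((sB (πB g))⁻¹ * g)) * h := by simp only [mul_assoc]
          _ = (((sB (πB g))⁻¹ * g) * (sB (πB h))⁻¹) * h := by rw [hc']
          _ = (sB (πB g))⁻¹ * g * ((sB (πB h))⁻¹ * h) := by simp only [mul_assoc] }
  have heM_cont : Continuous eM := by
    show Continuous fun g : ↥M' => (πB g, (⟨(sB (πB g))⁻¹ * g, hsec g⟩ : ↥K))
    exact hπB_cont.prodMk (((hsB_cont.comp hπB_cont).inv.mul continuous_id).subtype_mk _)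
  have heM_symm_cont : Continuous eM.symm := by
    show Continuous fun q : (↥(unitaryGroupOfForm (starRingEnd ℂ) ((Matrix.diagonal ![(α ∘ τ1) 0, (α ∘ τ1) 2]).map w₁.1.embedding)) × ↥(unitaryGroupOfForm (starRingEnd ℂ) ((Matrix.diagonal ![(α ∘ τ2) 0, (α ∘ τ2) 2]).map w₂.1.embedding))) × ↥K => sB q.1 * (q.2 : ↥M')
    exact (hsB_cont.comp continuous_fst).mul (continuous_subtype_val.comp continuous_snd)
  let e : ↥M' ≃ₜ* ((↥(unitaryGroupOfForm (starRingEnd ℂ) ((Matrix.diagonal ![(α ∘ τ1) 0, (α ∘ τ1) 2]).map w₁.1.embedding)) × ↥(unitaryGroupOfForm (starRingEnd ℂ) ((Matrix.diagonal ![(α ∘ τ2) 0, (α ∘ τ2) 2]).map w₂.1.embedding))) × ↥K) :=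
    { eM with continuous_toFun := heM_cont, continuous_invFun := heM_symm_cont }
  have he_fst : ∀ g : ↥M', (e g).1 = πB g := fun _ => rfl
  -- §F  Torus bookkeeping.
  have mem_T_of_local : ∀ x : G, (∀ w, ∃ cw : Fin 3 → ℝ, ((Φ x w : ↥(archLocal L 3 (Matrix.diagonal α) w)) : GL (Fin 3) ℂ) =
      ((gprimeBlock L α w S' (fun _ => cw) : ↥(archLocal L 3 (Matrix.diagonal α) w)) : GL (Fin 3) ℂ)) → x ∈ chartTorusG L α S' := by
    intro x hx
    choose c' hc' using hx
    have hxeq : x = gprimeTorus L α S' (fun w => c' w) := by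
      apply Φ.injective
      funext w
      apply Subtype.ext
      rw [hc' w, hΦγ1]
      rfl
    rw [hxeq]
    exact gprimeTorus_mem_chartTorusG L α S' _
  have hone_loc : ∀ w, ∃ cw : Fin 3 → ℝ, (((1 : ∀ w : {w : InfinitePlace L // IsComplex w}, ↥(archLocal L 3 (Matrix.diagonal α) w)) w : ↥(archLocal L 3 (Matrix.diagonal α) w)) : GL (Fin 3) ℂ) =
      ((gprimeBlock L α w S' (fun _ => cw) : ↥(archLocal L 3 (Matrix.diagonal α) w)) : GL (Fin 3) ℂ) := by
    intro w
    refine ⟨0, ?_⟩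
    rw [← hΦγ1 (fun _ => (0 : Fin 3 → ℝ)) w]
    have h0 : gprimeTorus L α S' (fun _ => (0 : Fin 3 → ℝ)) = 1 := gprimeTorus_zero L α S'
    rw [h0, map_one]
  -- elements of `K` are chart points: `K ≤ T′`
  have hKT : ∀ k : ↥M', k ∈ K → (k : G) ∈ chartTorusG L α S' := by
    intro k hk
    have hk0 : πB k = 1 := (hK_mem k).1 hk
    have hk₁ : π1B k = 1 := by have h := congrArg Prod.fst hk0; rw [hπB_apply] at h; exact h
    have hk₂ : π2B k = 1 := by have h := congrArg Prod.snd hk0; rw [hπB_apply] at h; exact h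
    have hkw := (commute_gprimeTorus_iff_forall L α S' p (k : G)).1 (Subgroup.mem_centralizer_singleton_iff.1 k.2)
    refine mem_T_of_local (k : G) fun w => ?_
    by_cases hw1 : w = w₁
    · subst hw1; exact hKloc1 k hk₁
    · by_cases hw2 : w = w₂
      · subst hw2; exact hKloc2 k hk₂
      · exact exists_coe_eq_gprimeBlock_of_commute L α S' hα hS' p w (hreg w hw1 hw2) (hregS w) _ (hkw w)
  -- `s(q)` is a chart point when both blocks are unit diagonals
  have hsT : ∀ (q : ↥(unitaryGroupOfForm (starRingEnd ℂ) ((Matrix.diagonal ![(α ∘ τ1) 0, (α ∘ τ1) 2]).map w₁.1.embedding)) × ↥(unitaryGroupOfForm (starRingEnd ℂ) ((Matrix.diagonal ![(α ∘ τ2) 0, (α ∘ τ2) 2]).map w₂.1.embedding))) (u v : Fin 2 → Circle),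
      circleDiagonal 2 u = (q.1 : GL (Fin 2) ℂ) → circleDiagonal 2 v = (q.2 : GL (Fin 2) ℂ) → ((sB q : ↥M') : G) ∈ chartTorusG L α S' := by
    intro q u v hu hv
    rw [hsB_apply, Subgroup.coe_mul, hsB1_coe, hsB2_coe]
    refine Subgroup.mul_mem _ (mem_T_of_local _ fun w => ?_) (mem_T_of_local _ fun w => ?_)
    · by_cases hw : w = w₁
      · subst hw; exact hjloc1 q.1 u hu
      · rw [hj1_ne _ w hw]; exact hone_loc w
    · by_cases hw : w = w₂
      · subst hw; exact hjloc2 q.2 v hv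
      · rw [hj2_ne _ w hw]; exact hone_loc w
  -- [4] the chart torus, read through `π_B`
  have hiff : ∀ g : ↥M', (g : G) ∈ chartTorusG L α S' ↔
      (((πB g).1 : ↥(unitaryGroupOfForm (starRingEnd ℂ) ((Matrix.diagonal ![(α ∘ τ1) 0, (α ∘ τ1) 2]).map w₁.1.embedding))) : GL (Fin 2) ℂ) ∈ Set.range (circleDiagonal 2) ∧
      (((πB g).2 : ↥(unitaryGroupOfForm (starRingEnd ℂ) ((Matrix.diagonal ![(α ∘ τ2) 0, (α ∘ τ2) 2]).map w₂.1.embedding))) : GL (Fin 2) ℂ) ∈ Set.range (circleDiagonal 2) := by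
    intro g
    constructor
    · intro hg
      have hD : IsClosed ({g : ↥M' | (((πB g).1 : ↥(unitaryGroupOfForm (starRingEnd ℂ) ((Matrix.diagonal ![(α ∘ τ1) 0, (α ∘ τ1) 2]).map w₁.1.embedding))) : GL (Fin 2) ℂ) ∈ Set.range (circleDiagonal 2)} ∩
          {g : ↥M' | (((πB g).2 : ↥(unitaryGroupOfForm (starRingEnd ℂ) ((Matrix.diagonal ![(α ∘ τ2) 0, (α ∘ τ2) 2]).map w₂.1.embedding))) : GL (Fin 2) ℂ) ∈ Set.range (circleDiagonal 2)}) :=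
        (((isCompact_range (continuous_circleDiagonal 2)).isClosed).preimage
          (continuous_subtype_val.comp (continuous_fst.comp hπB_cont))).inter
        (((isCompact_range (continuous_circleDiagonal 2)).isClosed).preimage
          (continuous_subtype_val.comp (continuous_snd.comp hπB_cont)))
      have hM'closed : IsClosed ((M' : Subgroup G) : Set G) := by
        have h : ((M' : Subgroup G) : Set G) = {g : G | g * gprimeTorus L α S' p = gprimeTorus L α S' p * g} := by
          ext g; exact Subgroup.mem_centralizer_singleton_iff
        rw [h]
        exact isClosed_eq (continuous_id.mul continuous_const) (continuous_const.mul continuous_id)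
      have hE : IsClosed (((↑) : ↥M' → G) '' ({g : ↥M' | (((πB g).1 : ↥(unitaryGroupOfForm (starRingEnd ℂ) ((Matrix.diagonal ![(α ∘ τ1) 0, (α ∘ τ1) 2]).map w₁.1.embedding))) : GL (Fin 2) ℂ) ∈ Set.range (circleDiagonal 2)} ∩
          {g : ↥M' | (((πB g).2 : ↥(unitaryGroupOfForm (starRingEnd ℂ) ((Matrix.diagonal ![(α ∘ τ2) 0, (α ∘ τ2) 2]).map w₂.1.embedding))) : GL (Fin 2) ℂ) ∈ Set.range (circleDiagonal 2)})) :=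
        hM'closed.isClosedEmbedding_subtypeVal.isClosedMap _ hD
      have hsub : ((gprimeTorusHom L α S').range : Set G) ⊆ ((↑) : ↥M' → G) '' ({g : ↥M' | (((πB g).1 : ↥(unitaryGroupOfForm (starRingEnd ℂ) ((Matrix.diagonal ![(α ∘ τ1) 0, (α ∘ τ1) 2]).map w₁.1.embedding))) : GL (Fin 2) ℂ) ∈ Set.range (circleDiagonal 2)} ∩
          {g : ↥M' | (((πB g).2 : ↥(unitaryGroupOfForm (starRingEnd ℂ) ((Matrix.diagonal ![(α ∘ τ2) 0, (α ∘ τ2) 2]).map w₂.1.embedding))) : GL (Fin 2) ℂ) ∈ Set.range (circleDiagonal 2)}) := by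
        rintro _ ⟨c, rfl⟩
        refine ⟨⟨gprimeTorus L α S' (Multiplicative.toAdd c), gprimeTorus_mem_centralizer L α S' p _⟩,
          ⟨⟨![Circle.exp ((Multiplicative.toAdd c) w₁ 0), Circle.exp ((Multiplicative.toAdd c) w₁ 2)], ?_⟩,
           ⟨![Circle.exp ((Multiplicative.toAdd c) w₂ 0), Circle.exp ((Multiplicative.toAdd c) w₂ 2)], ?_⟩⟩, rfl⟩
        · show _ = ((π1 _).1 : GL (Fin 2) ℂ)
          rw [htorus1]
        · show _ = ((π2 _).1 : GL (Fin 2) ℂ)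
          rw [htorus2]
      have hcl : (chartTorusG L α S' : Set G) ⊆ ((↑) : ↥M' → G) '' ({g : ↥M' | (((πB g).1 : ↥(unitaryGroupOfForm (starRingEnd ℂ) ((Matrix.diagonal ![(α ∘ τ1) 0, (α ∘ τ1) 2]).map w₁.1.embedding))) : GL (Fin 2) ℂ) ∈ Set.range (circleDiagonal 2)} ∩
          {g : ↥M' | (((πB g).2 : ↥(unitaryGroupOfForm (starRingEnd ℂ) ((Matrix.diagonal ![(α ∘ τ2) 0, (α ∘ τ2) 2]).map w₂.1.embedding))) : GL (Fin 2) ℂ) ∈ Set.range (circleDiagonal 2)}) := by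
        show ((gprimeTorusHom L α S').range.topologicalClosure : Set G) ⊆ _
        rw [Subgroup.topologicalClosure_coe]
        exact closure_minimal hsub hE
      obtain ⟨g', hg', hgg'⟩ := hcl hg
      have : g' = g := Subtype.ext hgg'
      rw [← this]
      exact hg'
    · rintro ⟨⟨u, hu⟩, ⟨v, hv⟩⟩
      have hg : (g : G) = ((sB (πB g) : ↥M') : G) * (((sB (πB g))⁻¹ * g : ↥M') : G) := by
        rw [← Subgroup.coe_mul, mul_inv_cancel_left]
      rw [hg]
      exact Subgroup.mul_mem _ (hsT (πB g) u v hu hv) (hKT _ (hsec g))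
  -- [6] the `K`-component of a chart point: zero the block slots at `w₁` and at `w₂`
  have hsnd : ∀ c : {w : InfinitePlace L // IsComplex w} → Fin 3 → ℝ,
      (((sB (πB ⟨gprimeTorus L α S' c, gprimeTorus_mem_centralizer L α S' p c⟩))⁻¹ * ⟨gprimeTorus L α S' c, gprimeTorus_mem_centralizer L α S' p c⟩ : ↥M') : G) =
        gprimeTorus L α S' (Function.update (Function.update c w₁ ![0, c w₁ 1, 0]) w₂ ![0, c w₂ 1, 0]) := by
    intro c
    have hmem' : gprimeTorus L α S' (Function.update (Function.update c w₁ ![0, c w₁ 1, 0]) w₂ ![0, c w₂ 1, 0]) ∈ M' :=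
      gprimeTorus_mem_centralizer L α S' p _
    have hupd₂ : Function.update (Function.update c w₁ ![0, c w₁ 1, 0]) w₂ ![0, c w₂ 1, 0] w₂ = ![0, c w₂ 1, 0] := Function.update_self _ _ _
    have hupd₁ : Function.update (Function.update c w₁ ![0, c w₁ 1, 0]) w₂ ![0, c w₂ 1, 0] w₁ = ![0, c w₁ 1, 0] := by
      rw [Function.update_of_ne h12, Function.update_self]
    -- one block slot zeroed: the local identity `diag(e^{ic}) = ι(diag(e^{ic₀}, e^{ic₂}), 1) · diag(e^{i(0,c₁,0)})`
    have hloc : ∀ (i : Fin 2) (w : {w : InfinitePlace L // IsComplex w}) (t : Fin 3 ≃ Fin 3) (cw d : Fin 3 → ℝ), d = ![0, cw 1, 0] →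
        (⟨circleDiagonal 3 (fun k => Circle.exp (cw k)), circleDiagonal_mem_archLocal_diagonal L 3 (α ∘ t) w _⟩ :
          ↥(unitaryGroupOfForm (starRingEnd ℂ) ((Matrix.diagonal (α ∘ t)).map w.1.embedding))) =
        endoEmb (starRingEnd ℂ) ((Matrix.diagonal ![(α ∘ t) 0, (α ∘ t) 2]).map w.1.embedding) ((Matrix.diagonal ![(α ∘ t) 1]).map w.1.embedding)
          ((Matrix.diagonal (α ∘ t)).map w.1.embedding) (endoForm_archLocal_diagonal L (α ∘ t) w)
          (⟨circleDiagonal 2 ![Circle.exp (cw 0), Circle.exp (cw 2)], (circleDiagonal_blocks_mem L (α ∘ t) w (fun k => Circle.exp (cw k))).1⟩, 1) *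
        ⟨circleDiagonal 3 (fun k => Circle.exp (d k)), circleDiagonal_mem_archLocal_diagonal L 3 (α ∘ t) w _⟩ := by
      intro _ w t cw d hd
      subst hd
      rw [circleDiagonal_eq_endoEmb L (α ∘ t) w (fun k => Circle.exp (cw k)),
        circleDiagonal_eq_endoEmb L (α ∘ t) w (fun k => Circle.exp ((![0, cw 1, 0] : Fin 3 → ℝ) k)), ← map_mul]
      congr 1
      refine Prod.ext (Subtype.ext ?_) (Subtype.ext ?_)
      · show circleDiagonal 2 ![Circle.exp (cw 0), Circle.exp (cw 2)] =
          circleDiagonal 2 ![Circle.exp (cw 0), Circle.exp (cw 2)] * circleDiagonal 2 ![Circle.exp ((![0, cw 1, 0] : Fin 3 → ℝ) 0), Circle.exp ((![0, cw 1, 0] : Fin 3 → ℝ) 2)]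
        have h0 : (![0, cw 1, 0] : Fin 3 → ℝ) 0 = 0 := rfl
        have h2 : (![0, cw 1, 0] : Fin 3 → ℝ) 2 = 0 := rfl
        rw [h0, h2, Circle.exp_zero]
        have h11 : (![(1 : Circle), 1] : Fin 2 → Circle) = 1 := by funext i; fin_cases i <;> rfl
        rw [h11, map_one, mul_one]
      · show circleDiagonal 1 ![Circle.exp (cw 1)] = 1 * circleDiagonal 1 ![Circle.exp ((![0, cw 1, 0] : Fin 3 → ℝ) 1)]
        rw [one_mul]
        rfl
    have hprod : (⟨gprimeTorus L α S' c, gprimeTorus_mem_centralizer L α S' p c⟩ : ↥M') =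
        sB (πB ⟨gprimeTorus L α S' c, gprimeTorus_mem_centralizer L α S' p c⟩) * ⟨_, hmem'⟩ := by
      apply Subtype.ext
      show gprimeTorus L α S' c = ((sB (πB ⟨gprimeTorus L α S' c, _⟩) : ↥M') : G) *
        gprimeTorus L α S' (Function.update (Function.update c w₁ ![0, c w₁ 1, 0]) w₂ ![0, c w₂ 1, 0])
      rw [hsB_apply, Subgroup.coe_mul, hsB1_coe, hsB2_coe, hπB_apply]
      apply Φ.injective
      funext w
      rw [map_mul, map_mul, Pi.mul_apply, Pi.mul_apply, hΦγ1, hΦγ1]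
      by_cases hw1 : w = w₁
      · subst hw1
        rw [hj1_w, hj2_ne _ _ h12, mul_one, hπ1B_apply, htorus1, hblk1 c, hblk1 (Function.update (Function.update c w ![0, c w 1, 0]) w₂ ![0, c w₂ 1, 0]),
          ← map_mul eτ1]
        congr 1
        simp only [hupd₁]
        exact hloc 0 w τ1 (c w) _ rfl
      · by_cases hw2 : w = w₂
        · subst hw2
          rw [hj1_ne _ _ hw1, hj2_w, one_mul, hπ2B_apply, htorus2, hblk2 c, hblk2 (Function.update (Function.update c w₁ ![0, c w₁ 1, 0]) w ![0, c w 1, 0]),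
            ← map_mul eτ2]
          congr 1
          simp only [hupd₂]
          exact hloc 1 w τ2 (c w) _ rfl
        · rw [hj1_ne _ w hw1, hj2_ne _ w hw2, one_mul, one_mul]
          refine gprimeBlock_congr_place L α S' w ?_
          rw [Function.update_of_ne hw2, Function.update_of_ne hw1]
    calc (((sB (πB ⟨gprimeTorus L α S' c, gprimeTorus_mem_centralizer L α S' p c⟩))⁻¹ *
            ⟨gprimeTorus L α S' c, gprimeTorus_mem_centralizer L α S' p c⟩ : ↥M') : G)
        = (((sB (πB ⟨gprimeTorus L α S' c, gprimeTorus_mem_centralizer L α S' p c⟩))⁻¹ *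
            (sB (πB ⟨gprimeTorus L α S' c, gprimeTorus_mem_centralizer L α S' p c⟩) * ⟨_, hmem'⟩) : ↥M') : G) := by rw [← hprod]
      _ = gprimeTorus L α S' (Function.update (Function.update c w₁ ![0, c w₁ 1, 0]) w₂ ![0, c w₂ 1, 0]) := by rw [inv_mul_cancel_left]
  -- §G  Assembly.
  refine ⟨K, e, ?_, hKT, ?_, hiff, ?_, ?_, hsnd, ?_, ?_, ?_, ?_, ?_, ?_⟩
  · -- `K` is closed
    show IsClosed ((πB.ker : Subgroup ↥M') : Set ↥M')
    rw [MonoidHom.coe_ker]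
    exact isClosed_singleton.preimage hπB_cont
  · -- `K` is commutative (it sits in the abelian `T′`)
    intro k₁ hk₁ k₂ hk₂
    have h := chartTorusG_mul_comm L α S' ⟨(k₁ : G), hKT k₁ hk₁⟩ ⟨(k₂ : G), hKT k₂ hk₂⟩
    have h' : (k₁ : G) * (k₂ : G) = (k₂ : G) * (k₁ : G) := congrArg Subtype.val h
    exact Subtype.ext h'
  · -- [5]₁
    intro c
    show (((π1 ⟨gprimeTorus L α S' c, gprimeTorus_mem_centralizer L α S' p c⟩).1 : ↥(unitaryGroupOfForm (starRingEnd ℂ) ((Matrix.diagonal ![(α ∘ τ1) 0, (α ∘ τ1) 2]).map w₁.1.embedding))) : GL (Fin 2) ℂ) =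
      circleDiagonal 2 ![Circle.exp (c w₁ 0), Circle.exp (c w₁ 2)]
    rw [htorus1]
  · -- [5]₂
    intro c
    show (((π2 ⟨gprimeTorus L α S' c, gprimeTorus_mem_centralizer L α S' p c⟩).1 : ↥(unitaryGroupOfForm (starRingEnd ℂ) ((Matrix.diagonal ![(α ∘ τ2) 0, (α ∘ τ2) 2]).map w₂.1.embedding))) : GL (Fin 2) ℂ) =
      circleDiagonal 2 ![Circle.exp (c w₂ 0), Circle.exp (c w₂ 2)]
    rw [htorus2]
  · -- [7] `e(T′) = (A₁ × A₂) × ⊤`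
    ext q
    simp only [Subgroup.mem_map, Subgroup.mem_subgroupOf, Subgroup.mem_prod, Subgroup.mem_top, and_true, MonoidHom.mem_range,
      MonoidHom.coe_coe]
    constructor
    · rintro ⟨g, hg, rfl⟩
      obtain ⟨⟨u, hu⟩, ⟨v, hv⟩⟩ := (hiff g).1 hg
      exact ⟨⟨u, Subtype.ext hu⟩, ⟨v, Subtype.ext hv⟩⟩
    · rintro ⟨⟨u, hu⟩, ⟨v, hv⟩⟩
      refine ⟨e.symm q, (hiff _).2 ⟨⟨u, ?_⟩, ⟨v, ?_⟩⟩, e.apply_symm_apply q⟩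
      · have h1 : πB (e.symm q) = q.1 := by
          show (e (e.symm q)).1 = q.1
          rw [e.apply_symm_apply]
        rw [h1, ← hu]
        rfl
      · have h1 : πB (e.symm q) = q.1 := by
          show (e (e.symm q)).1 = q.1
          rw [e.apply_symm_apply]
        rw [h1, ← hv]
        rfl
  · -- [8]₁ `e⁻¹ ((b₁, 1), 1) = s₁ b₁`, read in `G′_∞`
    intro b₁
    show (((sB (b₁, 1) * ((1 : ↥K) : ↥M')) : ↥M') : G) = _
    rw [Subgroup.coe_one, mul_one, hsB_apply]
    show (((sB1 b₁ * sB2 1) : ↥M') : G) = _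
    rw [map_one, mul_one, hsB1_coe]
    show j1 b₁ = Φ.symm (Pi.mulSingle w₁ (eτ1 (ι1 (b₁, 1))))
    apply Φ.injective
    show Φ (j1 b₁) = Φ (Φ.symm (Pi.mulSingle w₁ (eτ1 (ι1 (b₁, 1)))))
    rw [hj1_apply, ContinuousMulEquiv.apply_symm_apply]
  · -- [8]₂ `e⁻¹ ((1, b₂), 1) = s₂ b₂`
    intro b₂
    show (((sB (1, b₂) * ((1 : ↥K) : ↥M')) : ↥M') : G) = _
    rw [Subgroup.coe_one, mul_one, hsB_apply]
    show (((sB1 1 * sB2 b₂) : ↥M') : G) = _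
    rw [map_one, one_mul, hsB2_coe]
    show j2 b₂ = Φ.symm (Pi.mulSingle w₂ (eτ2 (ι2 (b₂, 1))))
    apply Φ.injective
    show Φ (j2 b₂) = Φ (Φ.symm (Pi.mulSingle w₂ (eτ2 (ι2 (b₂, 1)))))
    rw [hj2_apply, ContinuousMulEquiv.apply_symm_apply]
  · -- [9]₁
    intro g
    refine ⟨(π1 g).2, ?_⟩
    show Φ (g : G) w₁ = eτ1 (ι1 (π1B g, (π1 g).2))
    rw [hcomp1 g, hπ1B_apply]
  · -- [9]₂
    intro g
    refine ⟨(π2 g).2, ?_⟩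
    show Φ (g : G) w₂ = eτ2 (ι2 (π2B g, (π2 g).2))
    rw [hcomp2 g, hπ2B_apply]
  · -- [10] `e k = (1, k)` on `K`
    intro k hk
    have hk1 : πB k = 1 := (hK_mem k).1 hk
    refine Prod.ext hk1 (Subtype.ext ?_)
    show (sB (πB k))⁻¹ * k = k
    rw [hk1, map_one, inv_one, one_mul]

end TwoWall

end Literature.NumberTheory.Automorphic.UnitaryGroup

end
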